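import Summits.FinalStateConjecture.FinalStateConjecture.Theses.PhaseMixingCapture
import Summits.FinalStateConjecture.FinalStateConjecture.Theorems.PhaseMixingCaptureCaptureSufficesC2DiagonalReduction

/-!
# `Assembly` (item `stmt-FinalStateConjecture-17346`, route `PhaseMixingCapture`, rev 19): reductions after the tame re-typing

Since the statement revision p126844 (re-type T2, 2026-08-16) and the route repair of rev 19 the
assembly item of route `PhaseMixingCapture` is the conjunctive, `CaptureSufficesTame`-free statement

`Assembly := NearExtremalKappaCapture ∧ BulkKerrCaptureC2 ∧ WeakCosmicCensorshipTame → FinalStateConjecture`.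

Unlike the route's deciding theorem `closes : NearExtremalKappaCapture → BulkKerrCaptureC2 →
WeakCosmicCensorshipTame → CaptureSufficesTame → FinalStateConjecture` it does NOT take the conditional
crux `CaptureSufficesTame := NearExtremalKappaCapture → BulkKerrCaptureC2 → WeakCosmicCensorshipTame →
FinalStateConjecture` (rank 6, item `stmt-FinalStateConjecture-17270`, the large-data dynamical front
end) as a hypothesis, so it is not bookkeeping: it IS that crux, uncurried (kernel-checked as
`CaptureSufficesTame.Negative.assembly_iff_captureSufficesTame`,
Theorems/CaptureSufficesTame/Negative/CounterexampleShape.lean). This file records, sorry-free and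
definition-free, the closing paths of the item that survive the revision — it supersedes the rev-16
records of Theorems/PhaseMixingCaptureAssemblyReduction.lean (item stmt-FinalStateConjecture-14987,
stated over the pre-revision `WeakCosmicCensorshipMGHD`; its `iff`/converse over plain genericity are
underivable after the re-typing and that module no longer elaborates against the rev-19 route file):

* `assembly_of_captureSufficesTame`, `captureSufficesTame_of_assembly` — the two directions of the
  currying: the item closes the moment `stmt-FinalStateConjecture-17270` does, and conversely a proof
  of the item is a proof of that crux;
* `weakCosmicCensorshipMGHD_of_weakCosmicCensorshipTame` — the re-typed rank 5 implies the
  pre-revision support `WeakCosmicCensorshipMGHD` (item stmt-FinalStateConjecture-9952) BY NAME (tame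
  genericity forgets to the topology-free notion); with the landed
  `PhaseMixingCaptureCaptureSufficesC2.captureSufficesTame_of_captureSufficesC2`
  (Theorems/PhaseMixingCaptureCaptureSufficesC2Implications.lean) and `assembly_of_captureSufficesTame`
  the pre-revision support `CaptureSufficesC2` (item stmt-FinalStateConjecture-14986) closes the item too;
* `weakCosmicCensorshipTame_of_finalStateConjecture`, `captureSufficesTame_of_finalStateConjecture` —
  NECESSITY by name: the summit implies its own rank-5 hypothesis and the rank-6 crux (hence the item,
  by `assembly_of_captureSufficesTame`); neither is refutable short of refuting the summit;
* `captureSufficesTame_of_dynamicalStubs`, `assembly_of_dynamicalStubs` — the line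
  `censorship-enters-diagonally` of the pre-revision crux PORTS WITH ONE FEWER STUB: its reduction
  `PhaseMixingCaptureCaptureSufficesC2.finalStateConjecture_of_tameLayer h₅ h₁ h₂ h₃`
  (Theorems/PhaseMixingCaptureCaptureSufficesC2DiagonalReduction.lean) is fed `h₅ :=` the crux's own
  third hypothesis `WeakCosmicCensorshipTame`, leaving the three DYNAMICAL stubs (quiet curves along
  censored curves, margin curves along quiet curves, tracked capture settles) as the whole content of
  `CaptureSufficesTame`, hence of this item.

No analysis, no new definitions.
-/

-- the doubled `FinalStateConjecture.FinalStateConjecture` path component trips dupNamespace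
set_option linter.dupNamespace false

noncomputable section

open scoped Manifold ContDiff Topology ENNReal
open Set Function

namespace Summit.FinalStateConjecture.FinalStateConjecture.Theorems.PhaseMixingCaptureAssemblyTame

open Literature.Geometry.Lorentzian
open Summit.FinalStateConjecture.FinalStateConjecture.Theses.PhaseMixingCapture
open Summit.FinalStateConjecture.FinalStateConjecture.Theorems.PhaseMixingCaptureCaptureSufficesC2
  (finalStateConjecture_of_tameLayer tameCensorship_of_finalStateConjecture)

/-! ## The item is the conditional crux, uncurried -/

/-- **Closing recipe**: a proof of the crux `CaptureSufficesTame` (item stmt-FinalStateConjecture-17270)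
closes the assembly item (`(X_near ∧ X_bulk ∧ W → FSC) ← (X_near → X_bulk → W → FSC)`, uncurrying;
the `iff` itself is the landed `CaptureSufficesTame.Negative.assembly_iff_captureSufficesTame`,
Theorems/CaptureSufficesTame/Negative/CounterexampleShape.lean, not restated here). [folklore] -/
theorem assembly_of_captureSufficesTame (hS : CaptureSufficesTame) : Assembly :=
  fun h ↦ hS h.1 h.2.1 h.2.2

/-- Conversely, **a proof of the assembly item is a proof of the crux** `CaptureSufficesTame`
(currying). [folklore] -/
theorem captureSufficesTame_of_assembly (h : Assembly) : CaptureSufficesTame :=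
  fun h₁ h₂ h₃ ↦ h ⟨h₁, h₂, h₃⟩

/-! ## Rank 5 by name: tame censorship forgets to plain censorship -/

/-- **Tame censorship forgets to plain censorship**: the re-typed rank-5 crux
`WeakCosmicCensorshipTame` implies the pre-revision rank-5 statement `WeakCosmicCensorshipMGHD`
(item stmt-FinalStateConjecture-9952), by `IsTameChristodoulouGeneric.isChristodoulouGeneric` (forget
the end, tameness and immersion of the escaping families). Composed with
`PhaseMixingCaptureCaptureSufficesC2.captureSufficesTame_of_captureSufficesC2` and
`assembly_of_captureSufficesTame`, the pre-revision support `CaptureSufficesC2` closes the item.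
[folklore] -/
theorem weakCosmicCensorshipMGHD_of_weakCosmicCensorshipTame (h : WeakCosmicCensorshipTame) :
    WeakCosmicCensorshipMGHD := by
  intro X _ _ _ _ _ _
  exact (h X).isChristodoulouGeneric

/-! ## Necessity by name -/

/-- **The summit implies its own rank-5 hypothesis** `WeakCosmicCensorshipTame` (tame genericity is
monotone under pointwise implication; by name, through
`PhaseMixingCaptureCaptureSufficesC2.tameCensorship_of_finalStateConjecture`). [folklore] -/
theorem weakCosmicCensorshipTame_of_finalStateConjecture (h : _root_.FinalStateConjecture) :
    WeakCosmicCensorshipTame := by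
  intro X _ _ _ _ _ _
  exact tameCensorship_of_finalStateConjecture h X

/-- **The summit implies the rank-6 crux** `CaptureSufficesTame` (drop the hypotheses); hence it
implies the item (`assembly_of_captureSufficesTame`), and `¬ Assembly` / `¬ CaptureSufficesTame`
would refute the summit (cf. `CaptureSufficesTame.Negative.not_captureSufficesTame_iff`). [folklore] -/
theorem captureSufficesTame_of_finalStateConjecture (h : _root_.FinalStateConjecture) :
    CaptureSufficesTame :=
  fun _ _ _ ↦ h

/-! ## The dynamical layer: line `censorship-enters-diagonally` ports with one fewer stub -/

/-- **The crux from the three dynamical stubs alone.** Hypotheses, verbatim the registered stubs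
`stub_quietAlongCensoredCurves` (`h₁`: along every tame admissible curve of censored data a tame
injective immersed admissible curve through the same base datum whose members off `0` are censored
and adiabatically tracked at every accuracy), `stub_marginAlongQuietCurves` (`h₂`: the same from quiet
curves to margin members, one complexity for all accuracies) and `stub_trackedCaptureSettles` (`h₃`:
a censored MGHD tracked at every accuracy with one complexity settles as the summit demands) of line
`censorship-enters-diagonally`; conclusion `CaptureSufficesTame`. The fourth stub of that line, tame
weak cosmic censorship in MGHD form, is now the crux's OWN third hypothesis `WeakCosmicCensorshipTame`
(by `δ`-unfolding), so it is fed in place of `h₅` in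
`PhaseMixingCaptureCaptureSufficesC2.finalStateConjecture_of_tameLayer`; the two capture hypotheses
stay idle as typed. [folklore] -/
theorem captureSufficesTame_of_dynamicalStubs
    (h₁ : ∀ (X : Type) [TopologicalSpace X] [ChartedSpace E3 X] [IsManifold (𝓡 3) ∞ X] [T2Space X]
      [SecondCountableTopology X] [ConnectedSpace X],
      ∀ (e : AFEnd X) (F : EuclideanSpace ℝ (Fin 1) → InitialDataSet (𝓡 3) X),
        InitialDataSet.IsTameDataFamily e 1 F →
          ((InitialDataSet.IsImmersedAtZero 1 F ∧ Function.Injective F) ∨ ∀ c, F c = F 0) →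
          (∀ c, F c ∈ admissibleVacuumData X) →
          (∀ c ≠ 0, (∃ 𝒟 : VacuumCauchyDevelopment (F c), 𝒟.IsMaximal) ∧
            ∀ 𝒟 : VacuumCauchyDevelopment (F c), 𝒟.IsMaximal →
              Summit.FinalStateConjecture.HasCompleteNullInfinity 𝒟.toCauchyDevelopment) →
          ∃ F' : EuclideanSpace ℝ (Fin 1) → InitialDataSet (𝓡 3) X,
            InitialDataSet.IsTameDataFamily e 1 F' ∧ F' 0 = F 0 ∧ Function.Injective F' ∧
              InitialDataSet.IsImmersedAtZero 1 F' ∧ (∀ c, F' c ∈ admissibleVacuumData X) ∧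
              ∀ c : EuclideanSpace ℝ (Fin 1), c ≠ 0 →
                ((∃ 𝒟 : VacuumCauchyDevelopment (F' c), 𝒟.IsMaximal) ∧
                  ∀ 𝒟 : VacuumCauchyDevelopment (F' c), 𝒟.IsMaximal →
                    Summit.FinalStateConjecture.HasCompleteNullInfinity 𝒟.toCauchyDevelopment) ∧
                ∀ 𝒟 : VacuumCauchyDevelopment (F' c), 𝒟.IsMaximal →
                  ∀ (L : ℝ) (ε : ℝ≥0∞) (R₀ : ℝ), 0 < L → 0 < ε →
                    ∃ (N : ℕ) (m₀ χ : ℝ), 0 < m₀ ∧ 0 ≤ χ ∧ χ < 1 ∧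
                      𝒟.IsAdiabaticallyTracked N m₀ χ ε L R₀)
    (h₂ : ∀ (X : Type) [TopologicalSpace X] [ChartedSpace E3 X] [IsManifold (𝓡 3) ∞ X] [T2Space X]
      [SecondCountableTopology X] [ConnectedSpace X],
      ∀ (e : AFEnd X) (F : EuclideanSpace ℝ (Fin 1) → InitialDataSet (𝓡 3) X),
        InitialDataSet.IsTameDataFamily e 1 F →
          ((InitialDataSet.IsImmersedAtZero 1 F ∧ Function.Injective F) ∨ ∀ c, F c = F 0) →
          (∀ c, F c ∈ admissibleVacuumData X) →
          (∀ c ≠ 0,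
            ((∃ 𝒟 : VacuumCauchyDevelopment (F c), 𝒟.IsMaximal) ∧
              ∀ 𝒟 : VacuumCauchyDevelopment (F c), 𝒟.IsMaximal →
                Summit.FinalStateConjecture.HasCompleteNullInfinity 𝒟.toCauchyDevelopment) ∧
            ∀ 𝒟 : VacuumCauchyDevelopment (F c), 𝒟.IsMaximal →
              ∀ (L : ℝ) (ε : ℝ≥0∞) (R₀ : ℝ), 0 < L → 0 < ε →
                ∃ (N : ℕ) (m₀ χ : ℝ), 0 < m₀ ∧ 0 ≤ χ ∧ χ < 1 ∧
                  𝒟.IsAdiabaticallyTracked N m₀ χ ε L R₀) →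
          ∃ F' : EuclideanSpace ℝ (Fin 1) → InitialDataSet (𝓡 3) X,
            InitialDataSet.IsTameDataFamily e 1 F' ∧ F' 0 = F 0 ∧ Function.Injective F' ∧
              InitialDataSet.IsImmersedAtZero 1 F' ∧ (∀ c, F' c ∈ admissibleVacuumData X) ∧
              ∀ c : EuclideanSpace ℝ (Fin 1), c ≠ 0 →
                ((∃ 𝒟 : VacuumCauchyDevelopment (F' c), 𝒟.IsMaximal) ∧
                  ∀ 𝒟 : VacuumCauchyDevelopment (F' c), 𝒟.IsMaximal →
                    Summit.FinalStateConjecture.HasCompleteNullInfinity 𝒟.toCauchyDevelopment) ∧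
                ∀ 𝒟 : VacuumCauchyDevelopment (F' c), 𝒟.IsMaximal →
                  ∃ (N : ℕ) (m₀ χ : ℝ), 0 < m₀ ∧ 0 ≤ χ ∧ χ < 1 ∧
                    ∀ (L : ℝ) (ε : ℝ≥0∞) (R₀ : ℝ), 0 < L → 0 < ε →
                      𝒟.IsAdiabaticallyTracked N m₀ χ ε L R₀)
    (h₃ : ∀ (X : Type) [TopologicalSpace X] [ChartedSpace E3 X] [IsManifold (𝓡 3) ∞ X] [T2Space X]
      [SecondCountableTopology X] [ConnectedSpace X],
      ∀ D ∈ admissibleVacuumData X, ∀ 𝒟 : VacuumCauchyDevelopment D, 𝒟.IsMaximal →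
        Summit.FinalStateConjecture.HasCompleteNullInfinity 𝒟.toCauchyDevelopment →
          (∃ (N : ℕ) (m₀ χ : ℝ), 0 < m₀ ∧ 0 ≤ χ ∧ χ < 1 ∧
            ∀ (L : ℝ) (ε : ℝ≥0∞) (R₀ : ℝ), 0 < L → 0 < ε → 𝒟.IsAdiabaticallyTracked N m₀ χ ε L R₀) →
          ∃ (O : Set 𝒟.carrier) (d : FinalStateDecomposition 𝒟.toSpacetime O 2),
            (∀ i, Kerr.IsSubextremal (d.mass i) (d.spin i)) ∧
              O = Summit.FinalStateConjecture.exteriorOf 𝒟.toCauchyDevelopment d.charted ∧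
                Summit.FinalStateConjecture.RaysStayInClosure 𝒟.toCauchyDevelopment O ∧
                  Summit.FinalStateConjecture.HasExhaustiveCharts d ∧
                    Summit.FinalStateConjecture.IsFutureOriented d) :
    CaptureSufficesTame :=
  fun _ _ h₅ ↦ finalStateConjecture_of_tameLayer h₅ h₁ h₂ h₃

/-- **The item from the three dynamical stubs alone** (same hypotheses as
`captureSufficesTame_of_dynamicalStubs`; conclusion `Assembly`, by uncurrying). [folklore] -/
theorem assembly_of_dynamicalStubs
    (h₁ : ∀ (X : Type) [TopologicalSpace X] [ChartedSpace E3 X] [IsManifold (𝓡 3) ∞ X] [T2Space X]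
      [SecondCountableTopology X] [ConnectedSpace X],
      ∀ (e : AFEnd X) (F : EuclideanSpace ℝ (Fin 1) → InitialDataSet (𝓡 3) X),
        InitialDataSet.IsTameDataFamily e 1 F →
          ((InitialDataSet.IsImmersedAtZero 1 F ∧ Function.Injective F) ∨ ∀ c, F c = F 0) →
          (∀ c, F c ∈ admissibleVacuumData X) →
          (∀ c ≠ 0, (∃ 𝒟 : VacuumCauchyDevelopment (F c), 𝒟.IsMaximal) ∧
            ∀ 𝒟 : VacuumCauchyDevelopment (F c), 𝒟.IsMaximal →
              Summit.FinalStateConjecture.HasCompleteNullInfinity 𝒟.toCauchyDevelopment) →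
          ∃ F' : EuclideanSpace ℝ (Fin 1) → InitialDataSet (𝓡 3) X,
            InitialDataSet.IsTameDataFamily e 1 F' ∧ F' 0 = F 0 ∧ Function.Injective F' ∧
              InitialDataSet.IsImmersedAtZero 1 F' ∧ (∀ c, F' c ∈ admissibleVacuumData X) ∧
              ∀ c : EuclideanSpace ℝ (Fin 1), c ≠ 0 →
                ((∃ 𝒟 : VacuumCauchyDevelopment (F' c), 𝒟.IsMaximal) ∧
                  ∀ 𝒟 : VacuumCauchyDevelopment (F' c), 𝒟.IsMaximal →
                    Summit.FinalStateConjecture.HasCompleteNullInfinity 𝒟.toCauchyDevelopment) ∧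
                ∀ 𝒟 : VacuumCauchyDevelopment (F' c), 𝒟.IsMaximal →
                  ∀ (L : ℝ) (ε : ℝ≥0∞) (R₀ : ℝ), 0 < L → 0 < ε →
                    ∃ (N : ℕ) (m₀ χ : ℝ), 0 < m₀ ∧ 0 ≤ χ ∧ χ < 1 ∧
                      𝒟.IsAdiabaticallyTracked N m₀ χ ε L R₀)
    (h₂ : ∀ (X : Type) [TopologicalSpace X] [ChartedSpace E3 X] [IsManifold (𝓡 3) ∞ X] [T2Space X]
      [SecondCountableTopology X] [ConnectedSpace X],
      ∀ (e : AFEnd X) (F : EuclideanSpace ℝ (Fin 1) → InitialDataSet (𝓡 3) X),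
        InitialDataSet.IsTameDataFamily e 1 F →
          ((InitialDataSet.IsImmersedAtZero 1 F ∧ Function.Injective F) ∨ ∀ c, F c = F 0) →
          (∀ c, F c ∈ admissibleVacuumData X) →
          (∀ c ≠ 0,
            ((∃ 𝒟 : VacuumCauchyDevelopment (F c), 𝒟.IsMaximal) ∧
              ∀ 𝒟 : VacuumCauchyDevelopment (F c), 𝒟.IsMaximal →
                Summit.FinalStateConjecture.HasCompleteNullInfinity 𝒟.toCauchyDevelopment) ∧
            ∀ 𝒟 : VacuumCauchyDevelopment (F c), 𝒟.IsMaximal →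
              ∀ (L : ℝ) (ε : ℝ≥0∞) (R₀ : ℝ), 0 < L → 0 < ε →
                ∃ (N : ℕ) (m₀ χ : ℝ), 0 < m₀ ∧ 0 ≤ χ ∧ χ < 1 ∧
                  𝒟.IsAdiabaticallyTracked N m₀ χ ε L R₀) →
          ∃ F' : EuclideanSpace ℝ (Fin 1) → InitialDataSet (𝓡 3) X,
            InitialDataSet.IsTameDataFamily e 1 F' ∧ F' 0 = F 0 ∧ Function.Injective F' ∧
              InitialDataSet.IsImmersedAtZero 1 F' ∧ (∀ c, F' c ∈ admissibleVacuumData X) ∧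
              ∀ c : EuclideanSpace ℝ (Fin 1), c ≠ 0 →
                ((∃ 𝒟 : VacuumCauchyDevelopment (F' c), 𝒟.IsMaximal) ∧
                  ∀ 𝒟 : VacuumCauchyDevelopment (F' c), 𝒟.IsMaximal →
                    Summit.FinalStateConjecture.HasCompleteNullInfinity 𝒟.toCauchyDevelopment) ∧
                ∀ 𝒟 : VacuumCauchyDevelopment (F' c), 𝒟.IsMaximal →
                  ∃ (N : ℕ) (m₀ χ : ℝ), 0 < m₀ ∧ 0 ≤ χ ∧ χ < 1 ∧
                    ∀ (L : ℝ) (ε : ℝ≥0∞) (R₀ : ℝ), 0 < L → 0 < ε →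
                      𝒟.IsAdiabaticallyTracked N m₀ χ ε L R₀)
    (h₃ : ∀ (X : Type) [TopologicalSpace X] [ChartedSpace E3 X] [IsManifold (𝓡 3) ∞ X] [T2Space X]
      [SecondCountableTopology X] [ConnectedSpace X],
      ∀ D ∈ admissibleVacuumData X, ∀ 𝒟 : VacuumCauchyDevelopment D, 𝒟.IsMaximal →
        Summit.FinalStateConjecture.HasCompleteNullInfinity 𝒟.toCauchyDevelopment →
          (∃ (N : ℕ) (m₀ χ : ℝ), 0 < m₀ ∧ 0 ≤ χ ∧ χ < 1 ∧
            ∀ (L : ℝ) (ε : ℝ≥0∞) (R₀ : ℝ), 0 < L → 0 < ε → 𝒟.IsAdiabaticallyTracked N m₀ χ ε L R₀) →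
          ∃ (O : Set 𝒟.carrier) (d : FinalStateDecomposition 𝒟.toSpacetime O 2),
            (∀ i, Kerr.IsSubextremal (d.mass i) (d.spin i)) ∧
              O = Summit.FinalStateConjecture.exteriorOf 𝒟.toCauchyDevelopment d.charted ∧
                Summit.FinalStateConjecture.RaysStayInClosure 𝒟.toCauchyDevelopment O ∧
                  Summit.FinalStateConjecture.HasExhaustiveCharts d ∧
                    Summit.FinalStateConjecture.IsFutureOriented d) :
    Assembly :=
  assembly_of_captureSufficesTame (captureSufficesTame_of_dynamicalStubs h₁ h₂ h₃)

end Summit.FinalStateConjecture.FinalStateConjecture.Theorems.PhaseMixingCaptureAssemblyTame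

end
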